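import Mathlib.FieldTheory.IsAlgClosed.AlgebraicClosure
import Literature.AnabelianGeometry.AbsoluteAnabelian.FreeProfiniteSurfaceRelatorCusp
import Literature.AnabelianGeometry.AbsoluteAnabelian.FreeProSigmaNonVacuity
import Literature.AnabelianGeometry.AbsoluteAnabelian.AbsTopILem45iModelProofs
import Literature.AnabelianGeometry.AbsoluteAnabelian.AbsTopIII.CcnTransgressionFreeGeom
import Literature.AnabelianGeometry.AbsoluteAnabelian.AbsTopIII.CurveModelProp14iiReduction
import Literature.AnabelianGeometry.AbsoluteAnabelian.AbsTopIII.Thm19bOfPresentationsHolds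
import Literature.GroupTheory.ProfiniteSubquotients
import HarnessLib

/-!
# [AbsTopIII] Thm. 1.9 (b) INHABITED at a genuine hyperbolic carrier: the closed surface of genus `g ≥ 2`, once punctured, profinitely

Mochizuki, *Topics in Absolute Anabelian Geometry III*, §1, Thm. 1.9 (b), manuscript p. 37 (lit key
`paper:url-5493eb38cbb7`): "One constructs the natural isomorphisms `I_z ⥲ μ_Ẑ(Π_U) := M_Z` — where
[...] `Y` is of genus `≥ 2`, `Z` is the canonical compactification of `Y`, the points of `Z ∖ U` are all
rational over the base field `k_Z` of `Z`, `z ∈ (Z ∖ U)(k_Z)` — via the technique of Proposition 1.4, (ii)."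

abc-iut-L4-t1's named fact `CurveModel.Thm_1_9_b M` (FACT-LIST F-0346; `CuspidalSynchronization.lean`)
types this RELATIVE TO A MODEL `M : CurveModel`; its universal closure is REFUTED (junk models,
`CurveModel.not_forall_thm_1_9_b`) and it is PROVED modulo cusp-synchronization presentations
(`CurveModel.thm_1_9_b_of_cuspSyncPresentations`, abc-iut-w5-d213 / abc-iut-L4-t1).  The positive
kernel witnesses so far were VACUOUS for (b): the once-punctured-torus model
(`CurveModel.exists_isCyclotomePresentation_oncePuncturedTorus`) has genus `1`, while (b) asks
`2 ≤ genus Z`.  This PROOF-ONLY file (no definitions) supplies a NON-VACUOUS inhabitant at a genuine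
HYPERBOLIC carrier — the `(g, r) = (g, 1)` case of print, `g ≥ 2`, profinitely (group theory:
`FreeProfiniteSurfaceRelatorCusp.lean`):

* `CurveModel.exists_thm_1_9_b_closedSurface` — for every `g ≥ 2` a model `M` over `k = ℚ̄`
  (`G_k = 1`, `Π = Δ`) with two curves `U ⊆ Z`: `Π_U := F̂_{2g} = ⟨a_i, b_i⟩^` (the profinite
  completion of `π₁` of the genus-`g` surface punctured once; free pro-{primes},
  `isFreeProOn_profiniteCompletion_freeGroup`), ONE cusp `z` with decomposition = inertia group
  `I_z := ⟨∏[a_i, b_i]⟩⁻`, `Π_Z := F̂_{2g} / ⟨⟨∏[a_i, b_i]⟩⟩⁻` (the profinite completion of the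
  surface group `π₁(Z_g) = ⟨a_i, b_i ∣ ∏[a_i, b_i]⟩`), `res :=` the quotient map (and the identity
  `Π_U → Π_U`); at `(U ⊆ Z, z)` EVERY hypothesis of the (b)-`∀` holds (scheme-like, `Z` proper of genus
  `g ≥ 2`, all cusps of `U` rational, `I_z` free procyclic), `(U ⊆ Z, z)` is a cyclotome presentation
  (Prop. 1.4 (ii) exact, by `isCuspidallyCentralExtension_iff_inf_eq_bot` and
  `IsFreeProOn.topologicalClosure_zpowers_surfaceRelator_inf_eq_bot`), `Δ_Z ≠ 1` (the character
  `F̂_{2g} → ℤ/2`, `a_0 ↦ 1`, kills `[P, P]⁻ ⊇ ⟨⟨c_g⟩⟩⁻` but not `a_0`),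
  `M.Prop_1_4_ii_transgression ∧ M.Prop_1_4_ii_sync` (abc-iut-f-076's instance-class theorems
  `prop_1_4_ii_transgression_of_isFreePro` / `prop_1_4_ii_sync_of_isFreePro`) and **`M.Thm_1_9_b`**
  (through `thm_1_9_b_of_cuspSyncPresentations`, the third curve `Z ∖ {z}` of the presentation being
  `U` itself): the `D_z`-equivariant synchronization `I_z ⥲ M_Z = Hom(H²(Δ_Z, Ẑ), Ẑ)` at the
  profinite SURFACE group, the transgression `Hom_cont(I_z, Ẑ) → H²(Δ_Z, Ẑ)` being bijective.

HONEST LABEL: a group-theoretic model (profinite completions of the topological fundamental groups of a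
closed orientable surface of genus `g` and of its once-punctured open, over an algebraically closed base
so that `Π = Δ`), not the étale `π₁` of a scheme (none is constructed in the tree); an inhabited
instance of the typed statement is consistency evidence for the typing, not the printed theorem (whose
content is the construction over a sub-`p`-adic base).  Nothing here bears on [IUTchIII] Cor. 3.12;
typed ≠ proved.
-/

noncomputable section

open CategoryTheory Topology
open scoped Pointwise

namespace Literature.AnabelianGeometry.AbsoluteAnabelian

open Literature.IUT.HodgeTheaters (profiniteCompletion toCompletion)

/-! ### §3 The closed-surface model of `CurveModel` and Thm. 1.9 (b) at it -/

namespace AbsTopIII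

/-- Over an algebraically closed field the absolute Galois group is trivial. [folklore] -/
private theorem subsingleton_absoluteGaloisGroup' (k : Type) [Field k] [IsAlgClosed k] :
    Subsingleton (Field.absoluteGaloisGroup k) := by
  refine ⟨fun σ τ => AlgEquiv.ext fun x => ?_⟩
  obtain ⟨a, rfl⟩ :=
    (IsAlgClosed.algebraMap_bijective_of_isIntegral (k := k) (K := AlgebraicClosure k)).2 x
  rw [AlgEquiv.commutes, AlgEquiv.commutes]

/-- For an extension whose Galois group is trivial, `Δ = Π`. [folklore] -/
private theorem geom_eq_top_of_subsingleton' (E : FundamentalExtension.{0}) [Subsingleton E.gal] :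
    E.geom = ⊤ := by
  rw [eq_top_iff]
  intro x _
  rw [FundamentalExtension.mem_geom]
  exact Subsingleton.elim _ _

/-- **[AbsTopIII] Thm. 1.9 (b) INHABITED at the once-punctured closed surface of genus `g ≥ 2`,
profinitely.**  For every `g ≥ 2` there is a model `M : CurveModel` over `k = ℚ̄` (`G_k = 1`, `Π = Δ`)
with two curves `U ⊆ Z` — `Π_U := F̂_{2g} = ⟨a_i, b_i⟩^`, ONE cusp `z` of `U` with decomposition =
inertia group `I_z := ⟨∏[a_i, b_i]⟩⁻`, `Π_Z := F̂_{2g} / ⟨⟨∏[a_i, b_i]⟩⟩⁻` (the profinite completion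
of the surface group of genus `g`), `res :=` the quotient map — such that AT `(U ⊆ Z, z)` every
hypothesis of the (b)-statement HOLDS (`U`, `Z` scheme-like, `Z` proper of genus `g`, all cusps of `U`
rational, `I_z` free procyclic — so `InertiaFreeProcyclic` (F-0406/F-2464) and `M.Prop_1_4_i` (F-0339)
hold), `(U ⊆ Z, z)` is a cyclotome presentation (Prop. 1.4 (ii) exact:
`⟨c_g⟩⁻ ∩ [⟨⟨c_g⟩⟩⁻, F̂_{2g}]⁻ = 1`), `Δ_Z ≠ 1`, the named facts `Prop_1_4_ii_transgression` (F-0338)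
and `Prop_1_4_ii_sync` (F-0365) hold at `M`, and **`M.Thm_1_9_b` (F-0346) holds** — NON-VACUOUSLY: the
`D_z`-equivariant synchronization `I_z ⥲ M_Z = Hom(H²(Δ_Z, Ẑ), Ẑ)` at the profinite surface group.
HONEST LABEL: group-theoretic model (profinite completions of topological `π₁`'s over an algebraically
closed base), not the étale `π₁` of a scheme. [cite: MochizukiAbsTopIII2015, Thm 1.9 (b) p.37] -/
theorem CurveModel.exists_thm_1_9_b_closedSurface (g : ℕ) (hg : 2 ≤ g) :
    ∃ (M : CurveModel.{0}) (U Z : M.Curve) (h : M.IsCofiniteOpen U Z) (z : (M.cusps U).Cusp),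
      M.IsScheme U ∧ M.IsScheme Z ∧ M.IsProper Z ∧ M.genus Z = g ∧
        (∀ c : (M.cusps U).Cusp, (M.cusps U).IsRational c) ∧
        FundamentalExtension.IsFreeProcyclic ((M.cusps U).Icusp z) ∧
        (M.cusps U).InertiaFreeProcyclic ∧ M.Prop_1_4_i ∧
        M.IsCyclotomePresentation h z ∧ (M.ext Z).geom ≠ ⊥ ∧
        M.Prop_1_4_ii_transgression ∧ M.Prop_1_4_ii_sync ∧ M.Thm_1_9_b := by
  classical
  have hg0 : 0 < g := by omega
  -- the base field `ℚ̄` and its trivial Galois group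
  haveI : Subsingleton (Field.absoluteGaloisGroup (AlgebraicClosure ℚ)) :=
    subsingleton_absoluteGaloisGroup' _
  -- `F̂_{2g}`, free profinite on the letters `a_i = gens (castAdd g i)`, `b_i = gens (natAdd g i)`
  let P : ProfiniteGrp.{0} := profiniteCompletion (FreeGroup (Fin (g + g)))
  let gens : Fin (g + g) → P := fun i => toCompletion (FreeGroup (Fin (g + g))) (FreeGroup.of i)
  have hP : IsFreeProOn P {p : ℕ | p.Prime} gens := isFreeProOn_profiniteCompletion_freeGroup (g + g)
  have hS : ∀ p : ℕ, p.Prime → p ∈ {p : ℕ | p.Prime} := fun p hp => hp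
  -- the cusp: `c = ∏ [a_i, b_i]`, `I = ⟨c⟩⁻`, `N = ⟨⟨I⟩⟩⁻`
  let c : P := ((List.finRange g).map fun i => gens (Fin.castAdd g i) * gens (Fin.natAdd g i) *
    (gens (Fin.castAdd g i))⁻¹ * (gens (Fin.natAdd g i))⁻¹).prod
  let I : Subgroup P := (Subgroup.zpowers c).topologicalClosure
  let N : Subgroup P := (Subgroup.normalClosure (I : Set P)).topologicalClosure
  have hIc : IsClosed (I : Set P) := Subgroup.isClosed_topologicalClosure _
  have hNc : IsClosed (N : Set P) := Subgroup.isClosed_topologicalClosure _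
  haveI hNn : N.Normal := Subgroup.is_normal_topologicalClosure _
  have hIfree : FundamentalExtension.IsFreeProcyclic I :=
    hP.isFreeProcyclic_topologicalClosure_zpowers_surfaceRelator hS hg0
  have hIle : I ≤ (⁅(⊤ : Subgroup P), (⊤ : Subgroup P)⁆).topologicalClosure :=
    topologicalClosure_zpowers_surfaceRelator_le _ _
  have hIN : I ⊓ (⁅N, (⊤ : Subgroup P)⁆).topologicalClosure = ⊥ :=
    hP.topologicalClosure_zpowers_surfaceRelator_inf_eq_bot hS hg0
  -- the quotient `F̂_{2g} / N` as a profinite group (the profinite surface group)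
  haveI : TotallyDisconnectedSpace (P ⧸ N) :=
    Literature.GroupTheory.ProfiniteSubquotients.totallyDisconnectedSpace_quotient N hNc
  let Q : ProfiniteGrp.{0} := ProfiniteGrp.of (P ⧸ N)
  -- the two extensions (`G = G_{ℚ̄} = 1`) and the quotient morphism
  let G : ProfiniteGrp.{0} := absoluteGaloisGrp (AlgebraicClosure ℚ)
  let E₁ : FundamentalExtension.{0} :=
    { arith := P, gal := G, aug := 1, aug_surjective := fun _ => ⟨1, Subsingleton.elim _ _⟩ }
  let E₀ : FundamentalExtension.{0} :=
    { arith := Q, gal := G, aug := 1, aug_surjective := fun _ => ⟨1, Subsingleton.elim _ _⟩ }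
  let π : P →ₜ* (P ⧸ N) :=
    { QuotientGroup.mk' N with continuous_toFun := QuotientGroup.continuous_mk }
  let q : E₁ ⟶ E₀ := ⟨π, ContinuousMonoidHom.id _, fun _ => Subsingleton.elim _ _⟩
  have hE₁ : E₁.geom = ⊤ := geom_eq_top_of_subsingleton' E₁
  have hE₀ : E₀.geom = ⊤ := geom_eq_top_of_subsingleton' E₀
  -- cusps: one cusp of `U` with `D = I`; none on `Z`
  let C₁ : E₁.CuspidalData :=
    { Cusp := PUnit
      Dcusp := fun _ => I
      Icusp := fun _ => I ⊓ E₁.geom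
      Icusp_eq := fun _ => rfl
      isClosed_Dcusp := fun _ => hIc
      eq_of_conj := fun x y _ _ => Subsingleton.elim x y }
  let C₀ : E₀.CuspidalData :=
    { Cusp := PEmpty
      Dcusp := fun x => x.elim
      Icusp := fun x => x.elim
      Icusp_eq := fun x => x.elim
      isClosed_Dcusp := fun x => x.elim
      eq_of_conj := fun x => x.elim }
  have hC₁ : ∀ x, C₁.Icusp x = I := fun x => by
    change I ⊓ E₁.geom = I
    rw [hE₁, inf_top_eq]
  -- the model: `Curve = {Z, U}` (`false ↦ Z`, `true ↦ U`); cofinite opens `U ⊆ U` (identity) and `U ⊆ Z`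
  let M : CurveModel.{0} :=
    { Curve := ULift.{1} Bool
      base := fun _ => AlgebraicClosure ℚ
      ext := fun V => cond V.down E₁ E₀
      galIso := fun V => by
        rcases V with ⟨_ | _⟩ <;> exact Iso.refl _
      cusps := fun V => by
        rcases V with ⟨_ | _⟩
        exacts [C₀, C₁]
      IsProper := fun V => V = ⟨false⟩
      IsScheme := fun _ => True
      genus := fun _ => g
      FunctionField := fun _ => AlgebraicClosure ℚ
      Point := fun _ => PUnit
      decomp := fun _ _ => ⊥
      IsNFCurve := fun _ => True
      IsNFPoint := fun _ _ => True
      IsNFRational := fun _ _ => True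
      IsNFConstant := fun _ _ => True
      NFFunctionField := fun _ => AlgebraicClosure ℚ
      IsStrictlyBelyiType := fun _ => False
      IsCofiniteOpen := fun V _ => V = ⟨true⟩
      res := fun {V V'} h => by
        subst h
        rcases V' with ⟨_ | _⟩
        exacts [q, 𝟙 E₁] }
  have hrat : C₁.IsRational PUnit.unit := fun g _ => ⟨1, I.one_mem, Subsingleton.elim _ _⟩
  -- the presentation `(U ⊆ Z, z)`
  have hpres : M.IsCyclotomePresentation (Ux := ⟨true⟩) (X := ⟨false⟩) rfl PUnit.unit := by
    have hker : cuspidalKernel q = (Subgroup.normalClosure (C₁.Icusp PUnit.unit : Set P)).topologicalClosure := by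
      rw [hC₁]
      change q.arith.toMonoidHom.ker ⊓ E₁.geom = N
      rw [hE₁, inf_top_eq]
      exact QuotientGroup.ker_mk' N
    refine
      { isScheme := ⟨trivial, trivial⟩
        isProper := rfl
        isRational := hrat
        isFreeProcyclic := by
          change FundamentalExtension.IsFreeProcyclic (C₁.Icusp PUnit.unit)
          rw [hC₁]
          exact hIfree
        kernel_eq := hker
        isCuspidallyCentral := ?_ }
    change IsCuspidallyCentralExtension q (C₁.Icusp PUnit.unit)
    rw [isCuspidallyCentralExtension_iff_inf_eq_bot q C₁ PUnit.unit hrat hker]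
    unfold cuspidallyCentralModulus
    rw [hker, hC₁, hE₁]
    exact hIN
  -- every cyclotome presentation of `M` is this one (a presentation `(U ⊆ U, z)` is excluded: `U` is
  -- not proper): the structural inputs of the instance-class theorems
  have hq : ∀ (Ux X : M.Curve) (h : M.IsCofiniteOpen Ux X) (x : (M.cusps Ux).Cusp),
      M.IsCyclotomePresentation h x →
        Set.SurjOn (M.res h).arith (M.ext Ux).geom (M.ext X).geom := by
    intro Ux X h x hp
    obtain rfl : Ux = ⟨true⟩ := h
    rcases X with ⟨_ | _⟩
    · change Set.SurjOn π E₁.geom E₀.geom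
      rw [hE₁, hE₀]
      rintro y -
      obtain ⟨w, rfl⟩ := QuotientGroup.mk_surjective y
      exact ⟨w, Subgroup.mem_top w, rfl⟩
    · have h' : (⟨true⟩ : ULift.{1} Bool) = ⟨false⟩ := hp.isProper
      cases h'
  have hIcomm : ∀ (Ux X : M.Curve) (h : M.IsCofiniteOpen Ux X) (x : (M.cusps Ux).Cusp),
      M.IsCyclotomePresentation h x →
        (M.cusps Ux).Icusp x ≤ (⁅(M.ext Ux).geom, (M.ext Ux).geom⁆).topologicalClosure := by
    intro Ux X h x _
    obtain rfl : Ux = ⟨true⟩ := h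
    change C₁.Icusp x ≤ (⁅E₁.geom, E₁.geom⁆).topologicalClosure
    rw [hC₁, hE₁]
    exact hIle
  have hfree : ∀ (Ux X : M.Curve) (h : M.IsCofiniteOpen Ux X) (x : (M.cusps Ux).Cusp),
      M.IsCyclotomePresentation h x → IsFreePro (M.ext Ux).geom {p : ℕ | p.Prime} := by
    intro Ux X h x _
    obtain rfl : Ux = ⟨true⟩ := h
    change IsFreePro E₁.geom {p : ℕ | p.Prime}
    rw [hE₁]
    let e : P ≃ₜ* (⊤ : Subgroup P) :=
      { Subgroup.topEquiv.symm with
        continuous_toFun := Continuous.subtype_mk continuous_id _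
        continuous_invFun := continuous_subtype_val }
    exact ⟨g + g, _, hP.of_continuousMulEquiv e⟩
  have h14t : M.Prop_1_4_ii_transgression := M.prop_1_4_ii_transgression_of_isFreePro hS hq hIcomm hfree
  have h14s : M.Prop_1_4_ii_sync := M.prop_1_4_ii_sync_of_isFreePro hS hq hIcomm hfree
  -- `D_z = I_z` dies in `Π_Z`
  have hImap : I.map π.toMonoidHom = ⊥ := by
    rw [eq_bot_iff]
    rintro _ ⟨i, hi, rfl⟩
    rw [Subgroup.mem_bot]
    change (QuotientGroup.mk i : P ⧸ N) = 1
    rw [QuotientGroup.eq_one_iff]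
    exact Subgroup.le_topologicalClosure _ (Subgroup.subset_normalClosure hi)
  -- Thm. 1.9 (b) at `M`: the cusp-synchronization presentation `U ⊆ Z ∖ {z} = U ⊆ Z`
  have h19b : M.Thm_1_9_b := by
    refine M.thm_1_9_b_of_cuspSyncPresentations fun U Z h hU hZ hZp hg2 hr => ?_
    obtain rfl : U = ⟨true⟩ := h
    rcases Z with ⟨_ | _⟩
    swap
    · have h' : (⟨true⟩ : ULift.{1} Bool) = ⟨false⟩ := hZp
      cases h'
    obtain ⟨sec⟩ := nonempty_ccnSection (M.res (U := ⟨true⟩) (U' := ⟨false⟩) rfl) (hq _ _ _ _ hpres)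
    refine ⟨{ Uz := fun _ => ⟨true⟩
              hU := fun _ => rfl
              hZ := fun _ => rfl
              res_comp := fun _ => Category.id_comp _
              cusp := fun _ => PUnit.unit
              pres := fun _ => hpres
              inertia_le := fun w => ?_
              inertia_bijOn := fun w => ?_
              sec := fun _ => sec
              bij := fun _ => h14t _ _ _ _ hpres sec
              pt := fun _ => PUnit.unit
              decomp_pt := fun w => ⟨1, ?_⟩
              pt_injective := fun a b _ => Subsingleton.elim a b }⟩
    · rcases w with ⟨⟩
      change (C₁.Icusp PUnit.unit).map (MonoidHom.id _) ≤ C₁.Icusp PUnit.unit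
      rw [Subgroup.map_id]
    · rcases w with ⟨⟩
      exact Set.bijOn_id _
    · rcases w with ⟨⟩
      change (C₁.Dcusp PUnit.unit).map π.toMonoidHom = MulAut.conj (1 : Q) • (⊥ : Subgroup Q)
      rw [map_one, one_smul]
      exact hImap
  have hIF : C₁.InertiaFreeProcyclic := fun w => by
    rw [hC₁]
    exact hIfree
  have h14i : M.Prop_1_4_i := by
    rintro ⟨_ | _⟩ -
    · exact fun w => w.elim
    · exact hIF
  refine ⟨M, ⟨true⟩, ⟨false⟩, rfl, PUnit.unit, trivial, trivial, rfl, rfl,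
    fun w => by rcases w with ⟨⟩; exact hrat, hIF PUnit.unit, hIF, h14i, hpres, ?_, h14t, h14s, h19b⟩
  -- `Δ_Z = F̂_{2g} / N ≠ 1`: the class of `a_0` is nontrivial, as `a_0 ∉ N ≤ [P, P]⁻` — via the continuous
  -- character `F̂_{2g} → ℤ/2` with `a_0 ↦ 1`, `b_0 ↦ 0` (it kills `[P, P]⁻ ⊇ N` but not `a_0`)
  change E₀.geom ≠ ⊥
  rw [hE₀]
  intro htop
  have h01 : Fin.castAdd g (⟨0, hg0⟩ : Fin g) ≠ Fin.natAdd g ⟨0, hg0⟩ := by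
    intro h
    have := congrArg Fin.val h
    simp at this
    omega
  have ha : (QuotientGroup.mk (gens (Fin.castAdd g ⟨0, hg0⟩)) : P ⧸ N) = 1 :=
    (Subgroup.eq_bot_iff_forall _).mp htop _ (Subgroup.mem_top _)
  rw [QuotientGroup.eq_one_iff] at ha
  letI : TopologicalSpace (Multiplicative (ZMod 2)) := ⊥
  haveI : DiscreteTopology (Multiplicative (ZMod 2)) := ⟨rfl⟩
  obtain ⟨χ, hχc, hχa, -⟩ := hP.exists_continuous_hom_pair hS h01 (Multiplicative (ZMod 2))
    (Multiplicative.ofAdd 1) 1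
  have hcl : IsClosed (χ.ker : Set P) := by
    rw [MonoidHom.coe_ker]
    exact (isClosed_discrete _).preimage hχc
  have hcomm : (⁅(⊤ : Subgroup P), (⊤ : Subgroup P)⁆).topologicalClosure ≤ χ.ker := by
    refine Subgroup.topologicalClosure_minimal _ ?_ hcl
    rw [← commutator_def]
    exact Abelianization.commutator_subset_ker χ
  have hχN : N ≤ χ.ker := by
    refine Subgroup.topologicalClosure_minimal _ ?_ hcl
    exact Subgroup.normalClosure_le_normal (hIle.trans hcomm)
  have := hχN ha
  rw [MonoidHom.mem_ker, hχa] at this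
  exact absurd this (by decide)

end AbsTopIII

end Literature.AnabelianGeometry.AbsoluteAnabelian

-- tree-health (abc-iut-w6-d081 g5, 2026-08-26T18:36Z): comment-only re-land of a STRANDED ACCEPT (accepted 16:16–16:20Z; serial farm import probe at 18:2xZ answers rc 75 «remote:stale:unbuilt», ≥ 120 min; dag tick #10 DIRECTOR FIELDS «accepted-without-olean > 60 min»);
-- declarations byte-identical to the accepted version; purpose = trigger the rebuild (rule of record: a re-land outside a reload window is served in 10–27 min). No content change.
-- tree-health (abc-iut-w6-d081 g5, 2026-08-26T19:49Z): SECOND comment-only re-land — the first re-land (18:37–18:55Z) was itself not built after 60 min while 1,064 of 1,069 files committed 18:34–18:59Z hub-wide were (the 5 exceptions all in Literature/AnabelianGeometry + Literature/AlgebraicGeometry/Frobenioids); declarations byte-identical.
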